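import Mathlib
import Summits.Ventures.PercRepro2.MixChordORows

/-!
# The penalty-free rows of the `o`-class: the `D·Z`-chord along `{o, a₁}` from two q-free rows
(blind cell PercRepro2, night-1 g21; proofs/NIGHT1-G21.md §1, §9)

g20's `oRows_identity` clears the `D`-chord along `f = {o, a₁}` into `q(1 − q)·[(1 − q)·oRow0 + q·Z₁·oRow1]`.
The `D·Z`-chord (`NMixChord normDZ`, the inductive step `Gc_nonneg_of_nMixChord_DZ`) differs from the
`D`-chord by the penalty `(1 − q)·Gc₀·D·(Z₀ − Z) = q(1 − q)·Gc₀·D·(Z₀ − Z₁)`, so its cleared deficit is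
`q(1 − q)·[(1 − q)·oRowDZ0 + q·Z₁·oRowDZ1]` with the PENALTY-FREE rows
`oRowDZ0 = oRow0 + Gc₀·D₀·(Z₀ − Z₁)·Z₁·D₀`, `oRowDZ1 = oRow1 + Gc₀·D₁·(Z₀ − Z₁)·D₀`
(**`oRowsDZ_identity`**; in conditional language these are `R₀ = (1 − γ⁰)B + d⁰Δσ_b[ΔK − (1 − γ⁰)Δσ₃]`,
`R₁ = (1 − γ⁰)B + d¹Δσ_bΔK` of NIGHT1-G21.md §1 — g20's `ROW₀`, `ROW₁` without the `−hΓ⁰` penalties).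
**`nMixChord_DZ_of_oRowsDZ`**: the `D·Z`-chord along the `o`-edge at every weight from the two rows.

Own code; standard axioms.
-/

namespace Summit.Ventures.PercRepro2

open UnionCluster CovForm

namespace Mix

section RowsDZ

variable {V : Type*} {E : Type*} [Fintype E] [DecidableEq E] [DecidableEq V] {R : Type*}
  [Field R] [LinearOrder R]

variable (p₀ p₁ : E → R) (ends : E → Sym2 V) (o a₁ a₂ a₃ b : V)

/-- **`oRowDZ0`** — the penalty-free first row (`q → 0`) of the `o`-class `D·Z`-chord. -/
noncomputable def oRowDZ0 : R :=
  oRow0 p₀ p₁ ends o a₁ a₂ a₃ b +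
    Gc p₀ ends o a₁ a₂ a₃ b * prob p₀ (PDEvent ends a₁ a₂ a₃) *
      (prob p₀ (avoidAll ends a₂ {a₁}) - prob p₁ (avoidAll ends a₂ {a₁})) *
      prob p₁ (avoidAll ends a₂ {a₁}) * prob p₀ (PDEvent ends a₁ a₂ a₃)

/-- **`oRowDZ1`** — the penalty-free second row (`q → 1`). -/
noncomputable def oRowDZ1 : R :=
  oRow1 p₀ p₁ ends o a₁ a₂ a₃ b +
    Gc p₀ ends o a₁ a₂ a₃ b * prob p₁ (PDEvent ends a₁ a₂ a₃) *
      (prob p₀ (avoidAll ends a₂ {a₁}) - prob p₁ (avoidAll ends a₂ {a₁})) *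
      prob p₀ (PDEvent ends a₁ a₂ a₃)

end RowsDZ

section IdentityDZ

variable {V : Type*} {E : Type*} [Fintype E] [DecidableEq E] [DecidableEq V] {R : Type*}
  [Field R] [LinearOrder R] [IsStrictOrderedRing R]

variable (p : E → R) (ends : E → Sym2 V) {o a₁ a₂ a₃ : V} (b : V) {f : E}

omit [DecidableEq V] in
/-- **The penalty-free two-rows identity along `f = {o, a₁}`.** -/
theorem oRowsDZ_identity (hf : ends f = s(o, a₁)) :
    (Gc p ends o a₁ a₂ a₃ b * prob (Function.update p f 0) (PDEvent ends a₁ a₂ a₃) *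
          prob (Function.update p f 0) (avoidAll ends a₂ {a₁}) -
        (1 - p f) * Gc (Function.update p f 0) ends o a₁ a₂ a₃ b * prob p (PDEvent ends a₁ a₂ a₃) *
          prob p (avoidAll ends a₂ {a₁})) *
      (prob (Function.update p f 1) (avoidAll ends a₂ {a₁}) *
        prob (Function.update p f 0) (PDEvent ends a₁ a₂ a₃)) =
    p f * (1 - p f) *
      ((1 - p f) * oRowDZ0 (Function.update p f 0) (Function.update p f 1) ends o a₁ a₂ a₃ b +
        p f * (prob (Function.update p f 1) (avoidAll ends a₂ {a₁}) *
          oRowDZ1 (Function.update p f 0) (Function.update p f 1) ends o a₁ a₂ a₃ b)) := by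
  have hid := oRows_identity p ends (a₂ := a₂) (a₃ := a₃) b hf
  have hZ := prob_eq_pin p (avoidAll ends a₂ {a₁}) f
  have hD := prob_eq_pin p (PDEvent ends a₁ a₂ a₃) f
  unfold oRowDZ0 oRowDZ1
  rw [hZ, hD]
  rw [hD] at hid
  linear_combination hid

omit [DecidableEq V] in
/-- **The `D·Z`-chord along `f = {o, a₁}` from the two penalty-free rows** (at every weight of `f`;
the open child's `Q`-mass positive — when it vanishes the chord is trivial). -/
theorem nMixChord_DZ_of_oRowsDZ (hp : IsProbVec p) (hf : ends f = s(o, a₁))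
    (hZ1 : 0 < prob (Function.update p f 1) (avoidAll ends a₂ {a₁}))
    (h0 : 0 ≤ oRowDZ0 (Function.update p f 0) (Function.update p f 1) ends o a₁ a₂ a₃ b)
    (h1 : 0 ≤ oRowDZ1 (Function.update p f 0) (Function.update p f 1) ends o a₁ a₂ a₃ b) :
    NMixChord (normDZ ends a₁ a₂ a₃) p ends o a₁ a₂ a₃ b f := by
  have hp0 : IsProbVec (Function.update p f 0) := hp.update f le_rfl zero_le_one
  have hq0 := hp.nonneg f
  have hq1 := hp.le_one f
  have hG1 : Gc (Function.update p f 1) ends o a₁ a₂ a₃ b = 0 :=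
    Gc_eq_zero_of_sure_conn_o _ ends o a₃ b (conn_a1_o_of_update_one p ends hf)
  have hid := oRowsDZ_identity p ends (a₂ := a₂) (a₃ := a₃) b hf
  have hD := EdmRow.prob_le_prob_update_zero_of_isLowerSet hp
    (EdmRow.isLowerSet_PDEvent ends a₁ a₂ a₃) f
  have hDn := prob_nonneg hp (PDEvent ends a₁ a₂ a₃)
  have hD0n := prob_nonneg hp0 (PDEvent ends a₁ a₂ a₃)
  unfold NMixChord normDZ
  rw [hG1, mul_zero, sub_zero]
  by_cases hD0 : prob (Function.update p f 0) (PDEvent ends a₁ a₂ a₃) = 0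
  · have : prob p (PDEvent ends a₁ a₂ a₃) = 0 := le_antisymm (hD0 ▸ hD) hDn
    rw [this, hD0, zero_mul, zero_mul, mul_zero, mul_zero]
  · have hD0pos : 0 < prob (Function.update p f 0) (PDEvent ends a₁ a₂ a₃) :=
      lt_of_le_of_ne hD0n (Ne.symm hD0)
    have hfac : 0 < prob (Function.update p f 1) (avoidAll ends a₂ {a₁}) *
        prob (Function.update p f 0) (PDEvent ends a₁ a₂ a₃) := mul_pos hZ1 hD0pos
    have hrhs : 0 ≤ p f * (1 - p f) *
        ((1 - p f) * oRowDZ0 (Function.update p f 0) (Function.update p f 1) ends o a₁ a₂ a₃ b +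
          p f * (prob (Function.update p f 1) (avoidAll ends a₂ {a₁}) *
            oRowDZ1 (Function.update p f 0) (Function.update p f 1) ends o a₁ a₂ a₃ b)) :=
      mul_nonneg (mul_nonneg hq0 (sub_nonneg.2 hq1))
        (add_nonneg (mul_nonneg (sub_nonneg.2 hq1) h0) (mul_nonneg hq0 (mul_nonneg hZ1.le h1)))
    rw [← hid] at hrhs
    have hkey := (mul_nonneg_iff_of_pos_right hfac).1 hrhs
    linarith

end IdentityDZ

end Mix

end Summit.Ventures.PercRepro2
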